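import Summits.PneNP.PneNP.Theorems.SymmetryBudgetWindowCanoniserGatesDefs

/-!
# Window canoniser, III: wiring of the shared and replay gates (definitions)

Route `PneNP/SymmetryBudget`, dichotomy `WindowBarrier` (stmt-PneNP-2145) / `NoHiddenOrder` (stmt-PneNP-14781);
continuation of `…WindowCanoniserNodesDefs.lean`.  Here: the wiring vocabulary (wires to atoms / negated atoms /
formula gates, padded majority counters, parameter-record and atom builders) and the argument wires of the SHARED
atoms and of the REPLAY atoms of every label — the gate-level transcription of the replay of the process
(Corneil–Goldberg states `(W, c)`, `Literature.…CGCanon`) described in the module docstring of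
`…WindowCanoniserNodesDefs.lean`:

* state of iteration `it+1` from iteration `it` (frozen if arrived/dead, else an individualisation step —
  refine the colouring with the selected vertex individualised, consume it — or a section step — restrict to the
  part containing `U`), `frz`/`now`/`cnt1`, the switched graph `sw` (a block is switched iff
  `|cell v|·|cell w| < 2·#edges`, one majority gate over `3n²` wires), reachability by `n` rounds of path doubling,
  connectivity, cell-size comparisons, the branching cell `bmc` (`CGCanon.bigMinCell`), the selected vertex `sel`
  (the unique `λ`-maximal vertex of `bmc ∩ X ∖ C`), the section move `pok`/`nWs`, and `n` rounds of ordered colour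
  refinement `fLT/fcge/fallb/flex` on `within G W` (as in the tree's `SymCR`).
Main-computation wiring, levels and the DAG follow in `…WiringMainDefs.lean` / `…DagDefs.lean`.
-/

-- `Summit.PneNP.PneNP.…` duplicates `PneNP` BY DESIGN (single-problem summit, D-0017 layout).
set_option linter.dupNamespace false

namespace Summit.PneNP.PneNP.Theorems

namespace WCan

open Finset Equiv Literature.Computability.Complexity

variable {K r n : ℕ}

/-! ### Window and outside indices of the input matrix -/

/-- The `i`-th WINDOW index of the `(r+n) × (r+n)` matrix: `r + i`. -/
def wv (r : ℕ) {n : ℕ} (i : Fin n) : Fin (r + n) := Fin.natAdd r i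

/-- The `o`-th OUTSIDE index: `o < r`. -/
def ov {r : ℕ} (n : ℕ) (o : Fin r) : Fin (r + n) := Fin.castAdd n o

/-! ### Wires and formula builders -/

/-- Wire to an atom. -/
abbrev wA (a : Atom K r n) : Wire K r n := Sum.inr (Node.atom a)
/-- Wire to a negated atom. -/
abbrev wN (a : Atom K r n) : Wire K r n := Sum.inr (Node.natom a)
/-- Wire to a width-8 formula. -/
abbrev w1 (f : N1 K r n) : Wire K r n := Sum.inr (Node.f1 f)
/-- Wire to a width-4 formula. -/
abbrev w2 (f : N2 K r n) : Wire K r n := Sum.inr (Node.f2 f)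
/-- Positive literal. -/
abbrev pos (a : Atom K r n) : Lit K r n := (a, true)
/-- Negative literal. -/
abbrev neg (a : Atom K r n) : Lit K r n := (a, false)

section Builders

variable [NeZero n]

/-- Parameter record with the vertex slots `vs`, the named slots set and all other slots at their (relabelling
invariant) defaults.  The vertex slots have NO default: an atom without vertex parameters is built with the
ambient vertex of its caller in every slot (`vec1 z`), which keeps every reference equivariant. -/
def prm (vs : Fin 5 → Fin n) (it : Fin (T n + 1) := 0) (rd : Fin (n + 1) := 0) (s : Fin (n + 1) := 0)
    (ns : Fin 3 → Fin n := fun _ => 0)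
    (h1 : Fin (n + 1) := 0) (h2 : Fin (n + 1) := 0) (o1 : Option (Fin r) := none) (o2 : Option (Fin r) := none)
    (us : Finset (Fin n) := ∅) (fl : Bool := false) (b : Fin (NB r n + 1) := 0) (bp : Fin (NBp r n + 1) := 0) :
    Prm r n :=
  ⟨it, rd, s, vs, ns, h1, h2, o1, o2, us, fl, b, bp⟩

/-- One number in every numeric slot. -/
def nvec1 (p : Fin n) : Fin 3 → Fin n := fun _ => p
/-- Two numbers (slots 0, 1). -/
def nvec2 (p q : Fin n) : Fin 3 → Fin n := fun i => if (i : ℕ) = 0 then p else q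
/-- Three numbers. -/
def nvec3 (p q o : Fin n) : Fin 3 → Fin n := fun i => if (i : ℕ) = 0 then p else if (i : ℕ) = 1 then q else o

/-- One vertex in every slot. -/
def vec1 (u : Fin n) : Fin 5 → Fin n := fun _ => u
/-- Two vertices (slots 0, 1; the rest repeat the last). -/
def vec2 (u v : Fin n) : Fin 5 → Fin n := fun i => if (i : ℕ) = 0 then u else v
/-- Three vertices. -/
def vec3 (u v w : Fin n) : Fin 5 → Fin n := fun i => if (i : ℕ) = 0 then u else if (i : ℕ) = 1 then v else w
/-- Four vertices. -/
def vec4 (u v w y : Fin n) : Fin 5 → Fin n :=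
  fun i => if (i : ℕ) = 0 then u else if (i : ℕ) = 1 then v else if (i : ℕ) = 2 then w else y

/-- The constant-true atom. -/
abbrev ttA : Atom K r n := .tt
/-- The constant-false atom. -/
abbrev ffA : Atom K r n := .ff

/-- Width-8 conjunction of a list of (at most 8) literals, padded with `tt`. -/
def n1and (ls : List (Lit K r n)) : N1 K r n := ⟨true, fun i => ls.getD i (pos ttA)⟩
/-- Width-8 disjunction of a list of literals, padded with `ff`. -/
def n1or (ls : List (Lit K r n)) : N1 K r n := ⟨false, fun i => ls.getD i (pos ffA)⟩
/-- A single literal as a width-8 formula. -/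
def litN1 (l : Lit K r n) : N1 K r n := n1and [l]
/-- Width-4 conjunction of width-8 formulas, padded with the true formula. -/
def n2and (xs : List (N1 K r n)) : N2 K r n := ⟨true, fun i => xs.getD i (n1and [])⟩
/-- Width-4 disjunction of width-8 formulas, padded with the false formula. -/
def n2or (xs : List (N1 K r n)) : N2 K r n := ⟨false, fun i => xs.getD i (n1or [])⟩
/-- `a ↔ b` on atoms, as a width-4 formula `(a ∧ b) ∨ (¬a ∧ ¬b)`. -/
def iffF (a b : Atom K r n) : N2 K r n := n2or [n1and [pos a, pos b], n1and [neg a, neg b]]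

/-- **Padded majority counter**: over `Fin.append ws pad` with `N - θ` true padding wires, `MAJ_{2N}` fires iff
at least `θ` of the `N` wires `ws` are true (`θ ≤ N`). -/
def cnt (N θ : ℕ) (ws : Fin N → Wire K r n) : Fin (N + N) → Wire K r n :=
  Fin.append ws fun k => if (k : ℕ) + θ < N then wA ttA else wA ffA

/-- The adjacency literal of the window graph (`ff` on the diagonal). -/
def adjLit (u v : Fin n) : Lit K r n := if u = v then pos ffA else pos (.sh .exV (prm (vs := vec2 u v)))
/-- The negated adjacency literal (`tt` on the diagonal). -/
def nadjLit (u v : Fin n) : Lit K r n := if u = v then pos ttA else neg (.sh .exV (prm (vs := vec2 u v)))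

/-! ### Atom builders (one per family; slots as read by the wiring) -/

/-- `exV u v`. -/
def aExV (u v : Fin n) : Atom K r n := .sh .exV (prm (vs := vec2 u v))
/-- `exO v o`. -/
def aExO (v : Fin n) (o : Fin r) : Atom K r n := .sh .exO (prm (vs := vec1 v) (o1 := some o))
/-- root colour order after `rd` rounds. -/
def aRLT (rd : Fin (n + 1)) (u w : Fin n) : Atom K r n := .sh .rLT (prm (rd := rd) (vs := vec2 u w))
/-- root neighbour-count comparison. -/
def aRcge (rd : Fin (n + 1)) (u v w : Fin n) : Atom K r n := .sh .rcge (prm (rd := rd) (vs := vec3 u v w))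
/-- root prefix conjunction. -/
def aRallb (rd : Fin (n + 1)) (u v w : Fin n) : Atom K r n := .sh .rallb (prm (rd := rd) (vs := vec3 u v w))
/-- root lexicographic clause. -/
def aRlex (rd : Fin (n + 1)) (u v : Fin n) : Atom K r n := .sh .rlex (prm (rd := rd) (vs := vec2 u v))

variable (L : Lab K n)

/-- `W it v`. -/
def aW (it : Fin (T n + 1)) (v : Fin n) : Atom K r n := .lab L .sW (prm (it := it) (vs := vec1 v))
/-- `LT it u w`. -/
def aLT (it : Fin (T n + 1)) (u w : Fin n) : Atom K r n := .lab L .sLT (prm (it := it) (vs := vec2 u w))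
/-- `C it v`. -/
def aC (it : Fin (T n + 1)) (v : Fin n) : Atom K r n := .lab L .sC (prm (it := it) (vs := vec1 v))
/-- `ARR it`. -/
def aARR (it : Fin (T n + 1)) (z : Fin n) : Atom K r n := .lab L .sARR (prm (vec1 z) (it := it))
/-- `DEAD it`. -/
def aDEAD (it : Fin (T n + 1)) (z : Fin n) : Atom K r n := .lab L .sDEAD (prm (vec1 z) (it := it))
/-- `frz it`. -/
def aFrz (it : Fin (T n + 1)) (z : Fin n) : Atom K r n := .lab L .frz (prm (vec1 z) (it := it))
/-- `now it`. -/
def aNow (it : Fin (T n + 1)) (z : Fin n) : Atom K r n := .lab L .now (prm (vec1 z) (it := it))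
/-- `cnt1 it`. -/
def aCnt1 (it : Fin (T n + 1)) (z : Fin n) : Atom K r n := .lab L .cnt1 (prm (vec1 z) (it := it))
/-- `sw it v w`. -/
def aSw (it : Fin (T n + 1)) (v w : Fin n) : Atom K r n := .lab L .sw (prm (it := it) (vs := vec2 v w))
/-- `reach it s u y`. -/
def aReach (it : Fin (T n + 1)) (s : Fin (n + 1)) (u y : Fin n) : Atom K r n :=
  .lab L .reach (prm (it := it) (rd := s) (vs := vec2 u y))
/-- `conn it`. -/
def aConn (it : Fin (T n + 1)) (z : Fin n) : Atom K r n := .lab L .conn (prm (vec1 z) (it := it))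
/-- `szGE it v w`. -/
def aSzGE (it : Fin (T n + 1)) (v w : Fin n) : Atom K r n := .lab L .szGE (prm (it := it) (vs := vec2 v w))
/-- `big it v`. -/
def aBig (it : Fin (T n + 1)) (v : Fin n) : Atom K r n := .lab L .big (prm (it := it) (vs := vec1 v))
/-- `bmc it v`. -/
def aBmc (it : Fin (T n + 1)) (v : Fin n) : Atom K r n := .lab L .bmc (prm (it := it) (vs := vec1 v))
/-- `sel it v`. -/
def aSel (it : Fin (T n + 1)) (v : Fin n) : Atom K r n := .lab L .sel (prm (it := it) (vs := vec1 v))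
/-- `hasSel it`. -/
def aHasSel (it : Fin (T n + 1)) (z : Fin n) : Atom K r n := .lab L .hasSel (prm (vec1 z) (it := it))
/-- `pok it`. -/
def aPok (it : Fin (T n + 1)) (z : Fin n) : Atom K r n := .lab L .pok (prm (vec1 z) (it := it))
/-- `nWs it v`. -/
def aNWs (it : Fin (T n + 1)) (v : Fin n) : Atom K r n := .lab L .nWs (prm (it := it) (vs := vec1 v))
/-- `fLT it rd u w`. -/
def aFLT (it : Fin (T n + 1)) (rd : Fin (n + 1)) (u w : Fin n) : Atom K r n :=
  .lab L .fLT (prm (it := it) (rd := rd) (vs := vec2 u w))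
/-- `fcge it rd u v w`. -/
def aFcge (it : Fin (T n + 1)) (rd : Fin (n + 1)) (u v w : Fin n) : Atom K r n :=
  .lab L .fcge (prm (it := it) (rd := rd) (vs := vec3 u v w))
/-- `fallb it rd u v w`. -/
def aFallb (it : Fin (T n + 1)) (rd : Fin (n + 1)) (u v w : Fin n) : Atom K r n :=
  .lab L .fallb (prm (it := it) (rd := rd) (vs := vec3 u v w))
/-- `flex it rd u v`. -/
def aFlex (it : Fin (T n + 1)) (rd : Fin (n + 1)) (u v : Fin n) : Atom K r n :=
  .lab L .flex (prm (it := it) (rd := rd) (vs := vec2 u v))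

/-- `y ∈ cell of v` (inside `W`), as a width-8 formula. -/
def WEF (it : Fin (T n + 1)) (v y : Fin n) : N1 K r n := n1and [pos (aW L it y), neg (aLT L it v y), neg (aLT L it y v)]
/-- its negation. -/
def nWEF (it : Fin (T n + 1)) (v y : Fin n) : N1 K r n := n1or [neg (aW L it y), pos (aLT L it v y), pos (aLT L it y v)]

end Builders

/-! ### Wiring of the shared atoms -/

section SharedArgs

variable [NeZero n]

/-- Wires of the shared atoms (see the module docstring of `…NodesDefs.lean`). -/
def SKind.args (k : SKind) (P : Prm r n) : Fin (k.fn n).1 → Wire K r n :=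
  match k with
  | .exV => fun a => if (a : ℕ) = 0 then Sum.inl (wv r (P.vs 0), wv r (P.vs 1)) else Sum.inl (wv r (P.vs 1), wv r (P.vs 0))
  | .exO =>
    match P.o1 with
    | none => fun _ => wA ffA
    | some o => fun a => if (a : ℕ) = 0 then Sum.inl (wv r (P.vs 0), ov n o) else Sum.inl (ov n o, wv r (P.vs 0))
  | .rLT =>
    match P.rd with
    | ⟨0, _⟩ => fun _ => wA ffA
    | ⟨t + 1, h⟩ => fun _ =>
      let t' : Fin (n + 1) := ⟨t, by omega⟩
      w2 (n2or [litN1 (pos (aRLT t' (P.vs 0) (P.vs 1))),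
        n1and [neg (aRLT t' (P.vs 0) (P.vs 1)), neg (aRLT t' (P.vs 1) (P.vs 0)), pos (aRlex t' (P.vs 0) (P.vs 1))]])
  | .rcge =>
    Fin.append
      (fun w' => w1 (n1and [adjLit (P.vs 0) w', neg (aRLT P.rd w' (P.vs 2)), neg (aRLT P.rd (P.vs 2) w')]))
      (fun w' => w1 (n1or [nadjLit (P.vs 1) w', pos (aRLT P.rd w' (P.vs 2)), pos (aRLT P.rd (P.vs 2) w')]))
  | .rallb => fun w' : Fin n =>
      w2 (n2or [litN1 (neg (aRLT P.rd w' (P.vs 2))),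
        n1and [pos (aRcge P.rd (P.vs 0) (P.vs 1) w'), pos (aRcge P.rd (P.vs 1) (P.vs 0) w')]])
  | .rlex => fun (w : Fin n) => w1 (n1and [neg (aRcge P.rd (P.vs 0) (P.vs 1) w), pos (aRallb P.rd (P.vs 0) (P.vs 1) w)])

end SharedArgs

/-! ### Wiring of the replay atoms -/

section ReplayArgs

variable [NeZero n] (L : Lab K n)

/-- The individualised order at round `0` of the refinement of iteration `it`: `u < w` in
`liftCol W (individualize c x)` for the selected `x` (`sel`). -/
def iLTW (it : Fin (T n + 1)) (u w : Fin n) : Wire K r n :=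
  if u = w then wA ffA else
    w2 (n2or [n1and [neg (aW L it u), pos (aW L it w)], n1and [pos (aW L it u), pos (aW L it w), pos (aSel L it u)],
      n1and [pos (aW L it u), pos (aW L it w), pos (aLT L it u w), neg (aSel L it u), neg (aSel L it w)]])

/-- The base case of reachability: `u = y ∈ W`, or a switched-graph edge inside `W`. -/
def reach0W (it : Fin (T n + 1)) (u y : Fin n) : Wire K r n :=
  if u = y then wA (aW L it u) else
    w2 (n2or [n1and [pos (aW L it u), pos (aW L it y), pos (aExV u y), neg (aSw L it u y)],
      n1and [pos (aW L it u), pos (aW L it y), neg (aExV u y), pos (aSw L it u y)]])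

/-- Wires of the replay atoms of label `L` (other families get dummy wires here). -/
def Kind.argsR (k : Kind) (P : Prm r n) : Fin (k.fn r n).1 → Wire K r n :=
  let U := L.1.U
  let X := L.1.X
  let lam := L.1.lam
  let ln : Fin (n + 1) := Fin.last n
  let z : Fin n := P.vs 0
  match k with
  | .sW =>
    match P.it with
    | ⟨0, _⟩ => fun _ => wA ttA
    | ⟨i + 1, h⟩ => fun _ =>
      let i' : Fin (T n + 1) := ⟨i, by omega⟩
      w2 (n2and [litN1 (pos (aW L i' (P.vs 0))), n1or [pos (aFrz L i' z), pos (aConn L i' z), pos (aNWs L i' (P.vs 0))]])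
  | .sLT =>
    match P.it with
    | ⟨0, _⟩ => fun _ => wA (aRLT ln (P.vs 0) (P.vs 1))
    | ⟨i + 1, h⟩ => fun _ =>
      let i' : Fin (T n + 1) := ⟨i, by omega⟩
      let u := P.vs 0
      let w := P.vs 1
      w2 (n2or [n1and [pos (aFrz L i' z), pos (aLT L i' u w)],
        n1and [neg (aFrz L i' z), pos (aConn L i' z), pos (aFLT L i' ln u w)],
        n1and [neg (aFrz L i' z), neg (aConn L i' z), neg (aNWs L i' u), pos (aNWs L i' w)],
        n1and [neg (aFrz L i' z), neg (aConn L i' z), pos (aNWs L i' u), pos (aNWs L i' w), pos (aLT L i' u w)]])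
  | .sC =>
    match P.it with
    | ⟨0, _⟩ => fun _ => wA ffA
    | ⟨i + 1, h⟩ => fun _ =>
      let i' : Fin (T n + 1) := ⟨i, by omega⟩
      w2 (n2or [litN1 (pos (aC L i' (P.vs 0))), n1and [neg (aFrz L i' z), pos (aConn L i' z), pos (aSel L i' (P.vs 0))]])
  | .sARR =>
    match P.it with
    | ⟨0, _⟩ => fun _ => wA ffA
    | ⟨i + 1, h⟩ => fun _ =>
      let i' : Fin (T n + 1) := ⟨i, by omega⟩
      w1 (n1or [pos (aARR L i' z), pos (aNow L i' z)])
  | .sDEAD =>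
    match P.it with
    | ⟨0, _⟩ => fun _ => wA ffA
    | ⟨i + 1, h⟩ => fun _ =>
      let i' : Fin (T n + 1) := ⟨i, by omega⟩
      w2 (n2or [litN1 (pos (aDEAD L i' z)), n1and [neg (aFrz L i' z), pos (aCnt1 L i' z)],
        n1and [neg (aFrz L i' z), pos (aConn L i' z), neg (aHasSel L i' z)],
        n1and ([neg (aFrz L i' z), neg (aConn L i' z)] ++ (if U = ∅ then [] else [neg (aPok L i' z)]))])
  | .frz => fun a : Fin 3 => if (a : ℕ) = 0 then wA (aARR L P.it z) else if (a : ℕ) = 1 then wA (aNow L P.it z) else wA (aDEAD L P.it z)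
  | .now =>
    Fin.append (fun v => if v ∈ U then wA (aW L P.it v) else wN (aW L P.it v))
      (fun v => if v ∈ X then wA (aC L P.it v) else wN (aC L P.it v))
  | .cnt1 => cnt n (n - 1) fun v => wN (aW L P.it v)
  | .sw =>
    let v := P.vs 0
    let w := P.vs 1
    let E : Fin (n * n) → Wire K r n := fun i =>
      let a := (finProdFinEquiv.symm i).1
      let b := (finProdFinEquiv.symm i).2
      w1 (n1and [pos (aW L P.it a), neg (aLT L P.it v a), neg (aLT L P.it a v), pos (aW L P.it b),
        neg (aLT L P.it w b), neg (aLT L P.it b w), adjLit a b])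
    let NP : Fin (n * n) → Wire K r n := fun i =>
      let a := (finProdFinEquiv.symm i).1
      let b := (finProdFinEquiv.symm i).2
      w1 (n1or [neg (aW L P.it a), pos (aLT L P.it v a), pos (aLT L P.it a v), neg (aW L P.it b),
        pos (aLT L P.it w b), pos (aLT L P.it b w)])
    cnt (n * n + n * n + n * n) (n * n + 1) (Fin.append (Fin.append E E) NP)
  | .reach =>
    match P.rd with
    | ⟨0, _⟩ => fun _ => reach0W L P.it (P.vs 0) (P.vs 1)
    | ⟨s + 1, h⟩ => fun z : Fin n =>
        let s' : Fin (n + 1) := ⟨s, by omega⟩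
        w1 (n1and [pos (aReach L P.it s' (P.vs 0) z), pos (aReach L P.it s' z (P.vs 1))])
  | .conn => fun i : Fin (n * n) =>
      let u := (finProdFinEquiv.symm i).1
      let y := (finProdFinEquiv.symm i).2
      w1 (n1or [neg (aW L P.it u), neg (aW L P.it y), pos (aReach L P.it ln u y)])
  | .szGE => Fin.append (fun y => w1 (WEF L P.it (P.vs 0) y)) (fun y => w1 (nWEF L P.it (P.vs 1) y))
  | .big => cnt n 2 fun y => w1 (WEF L P.it (P.vs 0) y)
  | .bmc =>
    let v := P.vs 0
    Fin.append
      (fun w => w2 (n2or [litN1 (neg (aW L P.it w)), litN1 (neg (aBig L P.it w)), litN1 (neg (aSzGE L P.it v w)),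
        n1and [pos (aSzGE L P.it w v), neg (aLT L P.it w v)]]))
      (fun a : Fin 2 => if (a : ℕ) = 0 then wA (aW L P.it v) else wA (aBig L P.it v))
  | .sel =>
    let v := P.vs 0
    Fin.append
      (fun w => if w ≠ v ∧ w ∈ X ∧ lam v ≤ lam w then w1 (n1or [neg (aBmc L P.it w), pos (aC L P.it w)]) else wA ttA)
      (fun a : Fin 2 => if (a : ℕ) = 0 then wA (aBmc L P.it v) else (if v ∈ X then wN (aC L P.it v) else wA ffA))
  | .hasSel => fun (v : Fin n) => wA (aSel L P.it v)
  | .pok => fun i : Fin (n * n) =>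
      let u := (finProdFinEquiv.symm i).1
      let u' := (finProdFinEquiv.symm i).2
      if u ∈ U ∧ u' ∈ U then wA (aReach L P.it ln u u') else wA ttA
  | .nWs => fun u : Fin n => if u ∈ U then wA (aReach L P.it ln u (P.vs 0)) else wA ffA
  | .fLT =>
    match P.rd with
    | ⟨0, _⟩ => fun _ => iLTW L P.it (P.vs 0) (P.vs 1)
    | ⟨t + 1, h⟩ => fun _ =>
      let t' : Fin (n + 1) := ⟨t, by omega⟩
      let u := P.vs 0
      let w := P.vs 1
      w2 (n2or [litN1 (pos (aFLT L P.it t' u w)),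
        n1and [neg (aFLT L P.it t' u w), neg (aFLT L P.it t' w u), pos (aFlex L P.it t' u w)]])
  | .fcge =>
    let u := P.vs 0
    let v := P.vs 1
    let w := P.vs 2
    Fin.append
      (fun w' => w1 (n1and [pos (aW L P.it u), pos (aW L P.it w'), adjLit u w', neg (aFLT L P.it P.rd w' w),
        neg (aFLT L P.it P.rd w w')]))
      (fun w' => w1 (n1or [neg (aW L P.it v), neg (aW L P.it w'), nadjLit v w', pos (aFLT L P.it P.rd w' w),
        pos (aFLT L P.it P.rd w w')]))
  | .fallb => fun w' : Fin n =>
      w2 (n2or [litN1 (neg (aFLT L P.it P.rd w' (P.vs 2))),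
        n1and [pos (aFcge L P.it P.rd (P.vs 0) (P.vs 1) w'), pos (aFcge L P.it P.rd (P.vs 1) (P.vs 0) w')]])
  | .flex => fun (w : Fin n) => w1 (n1and [neg (aFcge L P.it P.rd (P.vs 0) (P.vs 1) w), pos (aFallb L P.it P.rd (P.vs 0) (P.vs 1) w)])
  | _ => fun _ => wA ffA

end ReplayArgs

end WCan

end Summit.PneNP.PneNP.Theorems
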